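import Summits.NavierStokesRegularity.FunctionalMining.StretchingFillerMinus
import Literature.Analysis.FunctionSpaces.TorusFourierCalculus
import HarnessLib

/-!
# K1-Q1, the wrap blueprint: node N3+ `PlanarFillerFamilyPotPlus` by the coordinate swap `x₁ ↔ x₂`

Cell `pub-nsfunc` (host summit NavierStokesRegularity, topic `FunctionalMining`), prove seat gen 5, kernel proof of node
**N3+ `PlanarFillerFamilyPotPlus`** (tubes along `e₁`) of the bank seat's `WRAP-KERNEL-BLUEPRINT.md` §6, from the
proved N3− (tubes along `e₂`, `StretchingFillerMinus.lean`) by the coordinate swap `x₁ ↔ x₂`.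
**Search for candidate a priori estimates; no regularity claim.** Static facts about smooth fields on `T³`.

For the swap `S(x) = (x₀, x₂, x₁)` and the swapped field `(𝔖u)(x) = (u₀, u₂, u₁)(Sx)`: `∇(𝔖u)(x) = P∇u(Sx)P`,
the vorticity components are permuted (and negated), `prodBC` is invariant, `S` preserves Haar measure
(Mathlib's `measurePreserving_arrowCongr'`); hence `|ω|²`, `ℰ`, `σ` are preserved and
`T₁₁ ↔ T₂₂`. The potential form is restored by `Confinement.exists_potential`.
Headline: `planarFillerFamilyPotPlus_holds : PlanarFillerFamilyPotPlus`.
-/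

noncomputable section

open MeasureTheory Set Filter Topology Function
open scoped InnerProductSpace ContDiff

namespace Summit.NavierStokesRegularity.FunctionalMining

open Literature.Analysis Literature.Analysis.FunctionSpaces Literature.Analysis.FunctionSpaces.Torus
open Literature.Analysis.FluidPDE Literature.Analysis.FluidPDE.Torus

namespace Swap12

open CellularStretching Confinement WrapStretching FillerMinus

/-! ## 1. The swap -/

/-- The transposition `1 ↔ 2` of `Fin 3`. [ours; bookkeeping] -/
def sw : Equiv.Perm (Fin 3) := Equiv.swap 1 2

/-- `sw` is an involution. [folklore] -/
@[simp] theorem sw_sw (k : Fin 3) : sw (sw k) = k := Equiv.swap_apply_self _ _ _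

/-- `sw.symm = sw`. [folklore] -/
@[simp] theorem sw_symm : sw.symm = sw := Equiv.symm_swap _ _

/-- Values of `sw`. [folklore] -/
theorem sw_vals : sw 0 = 0 ∧ sw 1 = 2 ∧ sw 2 = 1 := by
  refine ⟨?_, ?_, ?_⟩ <;> decide

/-- The coordinate swap `S(x)_k = x_{sw k}` on `T³`. [ours; bookkeeping] -/
def S (x : UnitAddTorus (Fin 3)) : UnitAddTorus (Fin 3) := fun k => x (sw k)

/-- `S` is additive. [folklore] -/
theorem S_add (x y : UnitAddTorus (Fin 3)) : S (x + y) = S x + S y := rfl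

/-- The linear swap on `E³`. [ours; bookkeeping] -/
def Slin : EuclideanSpace ℝ (Fin 3) →L[ℝ] EuclideanSpace ℝ (Fin 3) :=
  ((LinearIsometryEquiv.piLpCongrLeft 2 ℝ ℝ sw).toContinuousLinearEquiv :
    EuclideanSpace ℝ (Fin 3) →L[ℝ] EuclideanSpace ℝ (Fin 3))

/-- Values of the linear swap. [folklore] -/
@[simp] theorem Slin_apply (v : EuclideanSpace ℝ (Fin 3)) (i : Fin 3) : Slin v i = v (sw i) := by
  simp [Slin, Equiv.piCongrLeft'_apply]

/-- `S ∘ proj = proj ∘ Slin`. [folklore] -/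
theorem S_proj (y : EuclideanSpace ℝ (Fin 3)) : S (proj y) = proj (Slin y) := by
  funext k; simp [S, proj_apply]

/-- The swap as a measurable equivalence (Mathlib's `arrowCongr'`). [folklore] -/
def Sequiv : UnitAddTorus (Fin 3) ≃ᵐ UnitAddTorus (Fin 3) :=
  MeasurableEquiv.arrowCongr' sw.symm (MeasurableEquiv.refl UnitAddCircle)

/-- `Sequiv = S` pointwise. [folklore] -/
theorem Sequiv_apply (z : UnitAddTorus (Fin 3)) : (Sequiv z : UnitAddTorus (Fin 3)) = S z := by
  funext k; rfl

/-- `S` preserves Haar measure (coordinate permutations preserve the product measure). [folklore] -/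
theorem measurePreserving_Sequiv : MeasurePreserving Sequiv (volume : Measure (UnitAddTorus (Fin 3))) volume := by
  unfold Sequiv
  rw [volume_pi]
  exact measurePreserving_arrowCongr' _ _ _ _ fun _ => MeasurePreserving.id _

/-- `∫ f ∘ S = ∫ f`. [folklore] -/
theorem integral_comp_S (f : UnitAddTorus (Fin 3) → ℝ) : ∫ x, f (S x) = ∫ x, f x := by
  have h := measurePreserving_Sequiv.integral_comp' (g := f)
  simp only [Sequiv_apply] at h
  exact h

/-! ## 2. The swapped field and its derivatives -/

/-- **The swapped field** `(𝔖u)(x) = P·u(Sx)`, `(𝔖u)_i(x) = u_{sw i}(Sx)`. [ours] -/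
def swapField (u : UnitAddTorus (Fin 3) → EuclideanSpace ℝ (Fin 3)) (x : UnitAddTorus (Fin 3)) :
    EuclideanSpace ℝ (Fin 3) :=
  Slin (u (S x))

variable {u : UnitAddTorus (Fin 3) → EuclideanSpace ℝ (Fin 3)}

/-- `u ∘ S` is smooth. [folklore] -/
theorem isSmooth_comp_S {F : Type*} [NormedAddCommGroup F] [NormedSpace ℝ F] {f : UnitAddTorus (Fin 3) → F}
    (hf : IsSmooth f) : IsSmooth (fun x => f (S x)) := by
  have e : Torus.lift (fun x => f (S x)) = fun y => Torus.lift f (Slin y) := by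
    funext y; simp only [Torus.lift_apply, S_proj]
  unfold IsSmooth
  rw [e]
  exact hf.comp Slin.contDiff

/-- **The swapped field is smooth.** [folklore] -/
theorem isSmooth_swapField (hu : IsSmooth u) : IsSmooth (swapField u) := by
  have h1 : IsSmooth (fun x => u (S x)) := isSmooth_comp_S hu
  exact h1.comp_clm Slin

/-- **Chain rule under the swap**: `∂_j(f ∘ S)(x) = (∂_{sw j}f)(Sx)`. [folklore] -/
theorem partialDeriv_comp_S {F : Type*} [NormedAddCommGroup F] [NormedSpace ℝ F] (f : UnitAddTorus (Fin 3) → F)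
    (j : Fin 3) (x : UnitAddTorus (Fin 3)) :
    Torus.partialDeriv j (fun y => f (S y)) x = Torus.partialDeriv (sw j) f (S x) := by
  unfold Torus.partialDeriv Torus.lineDeriv
  congr 1
  funext t
  dsimp only
  rw [S_add]
  congr 2
  funext k
  simp only [S, proj_apply, PiLp.smul_apply, PiLp.single_apply, smul_eq_mul]
  by_cases hk : k = sw j
  · subst hk; simp
  · have hk' : sw k ≠ j := fun h => hk (by rw [← h, sw_sw])
    simp [hk, hk']

/-- **`∂_j(𝔖u)(x) = P·(∂_{sw j}u)(Sx)`.** [folklore] -/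
theorem partialDeriv_swapField (hu : IsSmooth u) (j : Fin 3) (x : UnitAddTorus (Fin 3)) :
    Torus.partialDeriv j (swapField u) x = Slin (Torus.partialDeriv (sw j) u (S x)) := by
  have h1 : IsSmooth (fun y => u (S y)) := isSmooth_comp_S hu
  rw [show swapField u = (Slin : EuclideanSpace ℝ (Fin 3) → EuclideanSpace ℝ (Fin 3)) ∘ (fun y => u (S y)) from rfl,
    partialDeriv_clm_comp h1, partialDeriv_comp_S]

/-- **`∇(𝔖u)(x)_{ij} = ∇u(Sx)_{sw i, sw j}`.** [ours; elementary] -/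
theorem gradAt_swapField (hu : IsSmooth u) (x : UnitAddTorus (Fin 3)) (i j : Fin 3) :
    gradAt (swapField u) x i j = gradAt u (S x) (sw i) (sw j) := by
  show Torus.partialDeriv j (swapField u) x i = Torus.partialDeriv (sw j) u (S x) (sw i)
  rw [partialDeriv_swapField hu, Slin_apply]

/-- **Vorticity of the swapped field**: `vort(∇𝔖u(x))_i = −vort(∇u(Sx))_{sw i}`. [ours; elementary] -/
theorem vort_gradAt_swapField (hu : IsSmooth u) (x : UnitAddTorus (Fin 3)) (i : Fin 3) :
    vort (gradAt (swapField u) x) i = -vort (gradAt u (S x)) (sw i) := by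
  have h := gradAt_swapField hu x
  obtain ⟨s0, s1, s2⟩ := sw_vals
  fin_cases i
  · show gradAt (swapField u) x 2 1 - gradAt (swapField u) x 1 2 = -vort (gradAt u (S x)) (sw 0)
    rw [h, h, s0, s1, s2]; simp [vort]
  · show gradAt (swapField u) x 0 2 - gradAt (swapField u) x 2 0 = -vort (gradAt u (S x)) (sw 1)
    rw [h, h, s0, s1, s2]; simp [vort]
  · show gradAt (swapField u) x 1 0 - gradAt (swapField u) x 0 1 = -vort (gradAt u (S x)) (sw 2)
    rw [h, h, s0, s1, s2]; simp [vort]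

/-- **`prodBC` is invariant under the swap.** [ours; elementary] -/
theorem prodBC_gradAt_swapField (hu : IsSmooth u) (x : UnitAddTorus (Fin 3)) :
    prodBC (gradAt (swapField u) x) = prodBC (gradAt u (S x)) := by
  have h := gradAt_swapField hu x
  obtain ⟨s0, s1, s2⟩ := sw_vals
  simp only [prodBC, Fin.sum_univ_three, h, s0, s1, s2]
  ring

/-- **The swapped field is divergence free with `u`.** [folklore] -/
theorem isDivFree_swapField (hu : IsSmooth u) (hdiv : IsDivFree u) : IsDivFree (swapField u) := by
  intro x
  have hsm := isSmooth_swapField hu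
  unfold Torus.divergence
  have e : ∀ i, Torus.partialDeriv i (fun y => swapField u y i) x = gradAt u (S x) (sw i) (sw i) := fun i => by
    rw [partialDeriv_apply_coord (hsm.isContDiff (by simp)), ← gradAt_swapField hu x i i]; rfl
  simp only [e]
  have h := hdiv (S x)
  unfold Torus.divergence at h
  have e2 : ∀ k, Torus.partialDeriv k (fun y => u y k) (S x) = gradAt u (S x) k k := fun k => by
    rw [partialDeriv_apply_coord (hu.isContDiff (by simp))]; rfl
  simp only [e2] at h
  obtain ⟨s0, s1, s2⟩ := sw_vals
  simp only [Fin.sum_univ_three, s0, s1, s2] at h ⊢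
  linarith

/-! ## 3. Statistics of the swapped field -/

/-- `|ω(𝔖u)(x)|² = |ω(u)(Sx)|²`. [ours; elementary] -/
theorem torusVorticitySqAt_swapField (hu : IsSmooth u) (x : UnitAddTorus (Fin 3)) :
    torusVorticitySqAt (swapField u) x = torusVorticitySqAt u (S x) := by
  rw [torusVorticitySqAt_eq_sum_sq, torusVorticitySqAt_eq_sum_sq, vorticityComp_eq_vort, vorticityComp_eq_vort]
  obtain ⟨s0, s1, s2⟩ := sw_vals
  simp only [Fin.sum_univ_three, vort_gradAt_swapField hu, s0, s1, s2]
  ring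

/-- `T_ii(𝔖u) = T_{sw i, sw i}(u)`. [ours; elementary] -/
theorem vorticityMoment_swapField (hu : IsSmooth u) (i : Fin 3) :
    vorticityMoment (swapField u) i i = vorticityMoment u (sw i) (sw i) := by
  rw [vorticityMoment_eq, vorticityMoment_eq]
  simp only [vort_gradAt_swapField hu, neg_sq]
  exact integral_comp_S (fun x => vort (gradAt u x) (sw i) ^ 2)

/-- `σ(𝔖u) = σ(u)`. [ours; elementary] -/
theorem enstrophyProduction_swapField (hu : IsSmooth u) (hdiv : IsDivFree u) :
    enstrophyProduction (swapField u) = enstrophyProduction u := by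
  rw [enstrophyProduction_eq_integral_prodBC (isSmooth_swapField hu) (isDivFree_swapField hu hdiv),
    enstrophyProduction_eq_integral_prodBC hu hdiv]
  simp only [prodBC_gradAt_swapField hu]
  exact integral_comp_S (fun x => prodBC (gradAt u x))

/-- `ℰ(𝔖u) = ℰ(u)`. [ours; elementary] -/
theorem torusEnstrophy_swapField (hu : IsSmooth u) (hdiv : IsDivFree u) :
    torusEnstrophy (swapField u) = torusEnstrophy u := by
  have h1 := two_mul_torusEnstrophy_eq_integral_vort (isSmooth_swapField hu) (isDivFree_swapField hu hdiv)
  have h2 := two_mul_torusEnstrophy_eq_integral_vort hu hdiv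
  obtain ⟨s0, s1, s2⟩ := sw_vals
  have e : (fun x => ∑ i, vort (gradAt (swapField u) x) i ^ 2) = fun x =>
      (fun y => ∑ i, vort (gradAt u y) i ^ 2) (S x) := by
    funext x
    simp only [Fin.sum_univ_three, vort_gradAt_swapField hu, s0, s1, s2]
    ring
  rw [e, integral_comp_S (fun y => ∑ i, vort (gradAt u y) i ^ 2)] at h1
  linarith

/-! ## 4. `PlanarFillerFamilyPotPlus` -/

/-- **N3+ of the bank's wrap blueprint holds: `PlanarFillerFamilyPotPlus`** (swap the N3− filler). Search for
candidate a priori estimates; no regularity claim. [ours] -/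
theorem planarFillerFamilyPotPlus_holds : PlanarFillerFamilyPotPlus := by
  intro ε hε
  obtain ⟨A, hA, hω, hσ, hE, hT⟩ := planarFillerFamilyPotMinus_holds ε hε
  have hF : IsSmooth (curlField A) := isSmooth_curlField hA
  have hdF : IsDivFree (curlField A) := isDivFree_curlField hA
  have hGs : IsSmooth (swapField (curlField A)) := isSmooth_swapField hF
  have hGd : IsDivFree (swapField (curlField A)) := isDivFree_swapField hF hdF
  obtain ⟨B, hB, hBω, hBE, hBσ, hBT⟩ := exists_potential hGs hGd
  obtain ⟨s0, s1, s2⟩ := sw_vals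
  refine ⟨B, hB, fun x => ?_, ?_, ?_, ?_⟩
  · rw [hBω, torusVorticitySqAt_swapField hF]; exact hω _
  · rw [hBσ, enstrophyProduction_swapField hF hdF]; exact hσ
  · rw [hBE, torusEnstrophy_swapField hF hdF]; exact hE
  · rw [hBT, hBT, vorticityMoment_swapField hF, vorticityMoment_swapField hF, s1, s2]; exact hT

end Swap12

end Summit.NavierStokesRegularity.FunctionalMining

end
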